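import Mathlib
import Summits.AtomisticToContinuum.Crystallization.Theses.PricedLinkCensus
import Literature.Geometry.DiscreteGeometry.BondGraph
import Literature.MathematicalPhysics.StatisticalMechanics.LennardJonesClusters

/-!
# Route PricedLinkCensus — `LayeringGlue : ZeroChargeBulk → ChargeFreeWindows`
(item `stmt-AtomisticToContinuum-14237`)

Zero link charge in the bulk implies charge-free windows of every fixed relative radius `R`
almost everywhere, by a double count. The only analytic input is a UNIFORM two-sided bound on
the own nearest-neighbour distance `nn_i` of every site of a Lennard-Jones ground state in `ℝ³`:

* `nn_i ≥ δ` — the proved minimal-distance theorem `LennardJonesMinimalDistance_holds`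
  (we use `δ = min δ₀ 1`);
* `nn_i ≤ 10/δ` (`nearestDist_le_of_isGroundState`) — from two lemmas proved here:
  (a) `siteEnergy_le_of_isGroundState`: in a Lennard-Jones ground state with at least two
  particles every site energy is `≤ V_LJ(1) = -1/12` (relocate the particle to distance `1`
  beyond the particle of largest first coordinate: all new distances are `≥ 1`, where
  `V_LJ ≤ 0`, and one of them equals `1`); (b) `sum_inv_pow_six_le_of_far`: the far-field shell
  sum `∑_{k ≠ i} |xᵢ - x_k|⁻⁶ ≤ 250 (D/δ)³ D⁻⁶` when all other particles are at distance `≥ D ≥ δ`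
  from `xᵢ` and mutually `δ`-separated (the shell argument of `sum_inv_pow_six_le` with shells of
  width `D` and packing radius `δ`). With `D = 10/δ` the site energy would be `≥ -1/24 > -1/12`.

Counting (`card_filter_window_le`): the sites `i` with `dist (x i) (x j) ≤ R · nn_i` for a fixed
`j` are `δ`-separated points of the ball of radius `R · D` about `x j`, hence number at most
`K = (2RD/δ + 1)³` (`card_le_of_separated_of_dist_le`). So the sites whose `R · nn_i`-window
contains a charged site number at most `K · #charged`, and the charged fraction tends to `0` by
`ZeroChargeBulk`.
-/

noncomputable section

namespace Summit.AtomisticToContinuum.Crystallization.Theorems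

open Summit.AtomisticToContinuum.Crystallization.Theses.PricedLinkCensus
open Literature.MathematicalPhysics.StatisticalMechanics Literature.Geometry.DiscreteGeometry
open Filter Topology

/-! ### Site energies in a ground state are at most `V_LJ(1) = -1/12` -/

/-- **Strengthened removal inequality.** In a Lennard-Jones ground state in `ℝᵈ` (`d ≥ 1`) with
at least two particles, every particle has site energy `∑_{k ≠ i} V_LJ(|xᵢ - x_k|) ≤ -1/12`:
move `xᵢ` to `x_m + e₁`, where `x_m` has the largest first coordinate among the other
particles; all the new distances are `≥ 1` (first coordinates differ by `≥ 1`), where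
`V_LJ ≤ 0`, and the distance to `x_m` is exactly `1`, where `V_LJ = -1/12`; the energy of the
modified configuration of distinct points is `≥ E(N)`. [folklore] -/
theorem siteEnergy_le_of_isGroundState {d N : ℕ} (hd : 0 < d)
    {x : Fin N → EuclideanSpace ℝ (Fin d)} (hx : IsGroundState lennardJones x) {i m : Fin N}
    (hmi : m ≠ i) : siteEnergy lennardJones x i ≤ -1 / 12 := by
  classical
  set e₀ : Fin d := ⟨0, hd⟩ with he₀
  -- the other particle with the largest first coordinate
  obtain ⟨m₀, hm₀, hmax⟩ := Finset.exists_max_image (Finset.univ.erase i) (fun k => x k e₀)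
    ⟨m, Finset.mem_erase.2 ⟨hmi, Finset.mem_univ m⟩⟩
  set y : EuclideanSpace ℝ (Fin d) := x m₀ + EuclideanSpace.single e₀ (1 : ℝ) with hy_def
  have hy0 : y e₀ = x m₀ e₀ + 1 := by simp [hy_def]
  have hy1 : ∀ k ∈ Finset.univ.erase i, 1 ≤ dist y (x k) := fun k hk => by
    have h1 : x k e₀ ≤ x m₀ e₀ := hmax k hk
    have h2 : dist (y e₀) (x k e₀) ≤ dist y (x k) := PiLp.dist_apply_le y (x k) e₀
    rw [Real.dist_eq, hy0, abs_of_nonneg (by linarith)] at h2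
    linarith
  have hym : dist y (x m₀) = 1 := by
    rw [dist_eq_norm, hy_def, add_sub_cancel_left]
    simp
  -- the modified configuration consists of distinct points
  have hy' : ∀ k, k ≠ i → y ≠ x k := fun k hk h => by
    have := hy1 k (Finset.mem_erase.2 ⟨hk, Finset.mem_univ k⟩)
    rw [h, dist_self] at this
    exact absurd this (by norm_num)
  have hinj : Function.Injective (Function.update x i y) := by
    intro a b hab
    by_cases ha : a = i <;> by_cases hb : b = i
    · exact ha.trans hb.symm
    · subst ha
      rw [Function.update_self, Function.update_of_ne hb] at hab
      exact absurd hab (hy' b hb)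
    · subst hb
      rw [Function.update_self, Function.update_of_ne ha] at hab
      exact absurd hab.symm (hy' a ha)
    · rw [Function.update_of_ne ha, Function.update_of_ne hb] at hab
      exact hx.1 hab
  have hle : interactionEnergy lennardJones x ≤
      interactionEnergy lennardJones (Function.update x i y) := by
    rw [hx.2]
    exact groundStateEnergy_lennardJones_le hinj
  have hdiff := sum_siteEnergy_update_sub lennardJones x i y
  -- the new site energy is at most `V_LJ(1) = -1/12`
  have hnew : ∑ k ∈ Finset.univ.erase i, lennardJones (dist y (x k)) ≤ -1 / 12 := by
    rw [← Finset.add_sum_erase _ _ hm₀, hym, lennardJones_one]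
    have : ∑ k ∈ (Finset.univ.erase i).erase m₀, lennardJones (dist y (x k)) ≤ 0 :=
      Finset.sum_nonpos fun k hk => lennardJones_nonpos (hy1 k (Finset.mem_of_mem_erase hk))
    linarith
  have h2 := two_mul_interactionEnergy lennardJones x
  have h2' := two_mul_interactionEnergy lennardJones (Function.update x i y)
  linarith

/-! ### The far-field shell sum -/

/-- **Far-field shell sum.** If the points of the configuration `x` in `ℝ³` are mutually
`δ`-separated (`δ > 0`) and every other point is at distance `≥ D ≥ δ` from `xᵢ`, then
`∑_{k ≠ i} |xᵢ - x_k|⁻⁶ ≤ 250 · (D/δ)³ · D⁻⁶`: the shell `⌊|xᵢ - x_k| / D⌋ = b` (`b ≥ 1`) lies in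
the ball of radius `(b+1) D` and so holds at most `(2(b+1)D/δ + 1)³ ≤ (2b+3)³ (D/δ)³ ≤ 125 b³ (D/δ)³`
points (`card_le_of_separated_of_dist_le`), each contributing `≤ (b D)⁻⁶`, and
`∑_{b ≥ 1} b⁻³ ≤ ∑_{b ≥ 1} b⁻² ≤ 2`. For `δ = D` this is `sum_inv_pow_six_le`. [folklore] -/
theorem sum_inv_pow_six_le_of_far {N : ℕ} (x : Fin N → EuclideanSpace ℝ (Fin 3)) {δ D : ℝ}
    (hδ : 0 < δ) (hδD : δ ≤ D) (hsep : ∀ k l, k ≠ l → δ ≤ dist (x k) (x l)) (i : Fin N)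
    (hfar : ∀ k, k ≠ i → D ≤ dist (x i) (x k)) :
    ∑ k ∈ Finset.univ.erase i, (dist (x i) (x k))⁻¹ ^ 6 ≤ 250 * (D / δ) ^ 3 * D⁻¹ ^ 6 := by
  have hD : 0 < D := hδ.trans_le hδD
  set s := Finset.univ.erase i with hs_def
  set m : Fin N → ℕ := fun k => ⌊dist (x i) (x k) / D⌋₊ with hm
  set t := s.image m with ht_def
  have hmem : ∀ k ∈ s, m k ∈ t := fun k hk => Finset.mem_image_of_mem m hk
  have hks : ∀ k ∈ s, D ≤ dist (x i) (x k) := fun k hk => hfar k (Finset.ne_of_mem_erase hk)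
  have hm1 : ∀ k ∈ s, 1 ≤ m k := fun k hk =>
    (Nat.one_le_floor_iff _).2 ((one_le_div hD).2 (hks k hk))
  have hmle : ∀ k ∈ s, D * m k ≤ dist (x i) (x k) := fun k hk => by
    have := Nat.floor_le (div_nonneg dist_nonneg hD.le : 0 ≤ dist (x i) (x k) / D)
    rwa [le_div_iff₀ hD, mul_comm] at this
  have hmlt : ∀ k ∈ s, dist (x i) (x k) < (m k + 1) * D := fun k hk => by
    have := Nat.lt_floor_add_one (dist (x i) (x k) / D)
    rwa [div_lt_iff₀ hD] at this
  -- termwise: `|xᵢ - x_k|⁻⁶ ≤ (D m_k)⁻⁶`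
  have step1 : ∑ k ∈ s, (dist (x i) (x k))⁻¹ ^ 6 ≤ ∑ k ∈ s, D⁻¹ ^ 6 * ((m k : ℝ))⁻¹ ^ 6 := by
    refine Finset.sum_le_sum fun k hk => ?_
    rw [← mul_pow, ← mul_inv]
    have h0 : 0 < D * m k := mul_pos hD (by exact_mod_cast hm1 k hk)
    exact pow_le_pow_left₀ (inv_nonneg.2 dist_nonneg) (inv_anti₀ h0 (hmle k hk)) _
  -- regroup by shells
  have step2 : ∑ k ∈ s, D⁻¹ ^ 6 * ((m k : ℝ))⁻¹ ^ 6 =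
      ∑ b ∈ t, ((s.filter fun k => m k = b).card : ℝ) * (D⁻¹ ^ 6 * ((b : ℝ))⁻¹ ^ 6) := by
    have := Finset.sum_fiberwise_of_maps_to' hmem (fun b : ℕ => D⁻¹ ^ 6 * ((b : ℝ))⁻¹ ^ 6)
    simp only [Finset.sum_const, nsmul_eq_mul] at this
    exact this.symm
  -- each shell holds at most `(2b+3)³ (D/δ)³` particles
  have hDδ : (1 : ℝ) ≤ D / δ := (one_le_div hδ).2 hδD
  have step3 : ∀ b ∈ t, ((s.filter fun k => m k = b).card : ℝ) ≤
      (2 * (b : ℝ) + 3) ^ 3 * (D / δ) ^ 3 := by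
    intro b _
    set F := s.filter fun k => m k = b with hF
    have hinj : Set.InjOn x F := fun k _ l _ hkl => by
      by_contra hne
      have := hsep k l hne
      rw [hkl, dist_self] at this
      exact absurd this (not_le.2 hδ)
    rw [← Finset.card_image_of_injOn hinj]
    have hR : (0 : ℝ) ≤ ((b : ℝ) + 1) * D := by positivity
    have := card_le_of_separated_of_dist_le (F.image x) (x i) hδ hR ?_ ?_
    · rw [finrank_euclideanSpace_fin] at this
      refine this.trans ?_
      rw [← mul_pow]
      refine pow_le_pow_left₀ (by positivity) ?_ 3
      have hq : 2 * (((b : ℝ) + 1) * D) / δ + 1 = (2 * (b : ℝ) + 2) * (D / δ) + 1 := by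
        field_simp
      rw [hq]
      nlinarith [hDδ, (Nat.cast_nonneg b : (0 : ℝ) ≤ b)]
    · intro c hc
      obtain ⟨k, hk, rfl⟩ := Finset.mem_image.1 hc
      obtain ⟨hks', hkb⟩ := Finset.mem_filter.1 hk
      rw [dist_comm]
      have := hmlt k hks'
      rw [hkb] at this
      exact this.le
    · intro c hc c' hc' hne
      obtain ⟨k, -, rfl⟩ := Finset.mem_image.1 hc
      obtain ⟨l, -, rfl⟩ := Finset.mem_image.1 hc'
      exact hsep k l fun h => hne (h ▸ rfl)
  -- numerics per shell: `(2b+3)³ b⁻⁶ ≤ 125 b⁻²` for `b ≥ 1`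
  have step4 : ∀ b ∈ t,
      (2 * (b : ℝ) + 3) ^ 3 * (D / δ) ^ 3 * (D⁻¹ ^ 6 * ((b : ℝ))⁻¹ ^ 6) ≤
        125 * (D / δ) ^ 3 * D⁻¹ ^ 6 * ((b : ℝ) ^ 2)⁻¹ := by
    intro b hb
    obtain ⟨k, hk, rfl⟩ := Finset.mem_image.1 hb
    have hb1 : (1 : ℝ) ≤ (m k : ℝ) := by exact_mod_cast hm1 k hk
    set β : ℝ := (m k : ℝ)
    have hβ : 0 < β := by linarith
    have hc6 : 0 < (D / δ) ^ 3 * D⁻¹ ^ 6 := by positivity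
    have key : (2 * β + 3) ^ 3 * (β⁻¹) ^ 6 ≤ 125 * (β ^ 2)⁻¹ := by
      rw [inv_pow, ← div_eq_mul_inv, ← div_eq_mul_inv,
        div_le_div_iff₀ (by positivity) (by positivity)]
      have h5 : (2 * β + 3) ^ 3 ≤ (5 * β) ^ 3 :=
        pow_le_pow_left₀ (by positivity) (by linarith) 3
      have h6 : β ^ 5 ≤ β ^ 6 := pow_le_pow_right₀ hb1 (by norm_num)
      nlinarith [mul_le_mul_of_nonneg_right h5 (sq_nonneg β)]
    calc (2 * β + 3) ^ 3 * (D / δ) ^ 3 * (D⁻¹ ^ 6 * (β⁻¹) ^ 6)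
        = (D / δ) ^ 3 * D⁻¹ ^ 6 * ((2 * β + 3) ^ 3 * (β⁻¹) ^ 6) := by ring
      _ ≤ (D / δ) ^ 3 * D⁻¹ ^ 6 * (125 * (β ^ 2)⁻¹) := mul_le_mul_of_nonneg_left key hc6.le
      _ = 125 * (D / δ) ^ 3 * D⁻¹ ^ 6 * (β ^ 2)⁻¹ := by ring
  -- `∑_{b ∈ t} b⁻² ≤ 2`
  have step5 : ∑ b ∈ t, ((b : ℝ) ^ 2)⁻¹ ≤ 2 := by
    have hsub : t ⊆ Finset.Ioo 0 (t.sup id + 1) := fun b hb => by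
      rw [Finset.mem_Ioo]
      obtain ⟨k, hk, rfl⟩ := Finset.mem_image.1 hb
      exact ⟨hm1 k hk, Nat.lt_succ_of_le (Finset.le_sup (f := id) hb)⟩
    have h2 := sum_Ioo_inv_sq_le (α := ℝ) 0 (t.sup id + 1)
    calc ∑ b ∈ t, ((b : ℝ) ^ 2)⁻¹ ≤ ∑ b ∈ Finset.Ioo 0 (t.sup id + 1), ((b : ℝ) ^ 2)⁻¹ :=
          Finset.sum_le_sum_of_subset_of_nonneg hsub fun b _ _ => by positivity
      _ ≤ 2 := by simpa using h2
  have hc6 : 0 ≤ (D / δ) ^ 3 * D⁻¹ ^ 6 := by positivity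
  calc ∑ k ∈ s, (dist (x i) (x k))⁻¹ ^ 6
      ≤ ∑ b ∈ t, ((s.filter fun k => m k = b).card : ℝ) * (D⁻¹ ^ 6 * ((b : ℝ))⁻¹ ^ 6) :=
        step1.trans_eq step2
    _ ≤ ∑ b ∈ t, (2 * (b : ℝ) + 3) ^ 3 * (D / δ) ^ 3 * (D⁻¹ ^ 6 * ((b : ℝ))⁻¹ ^ 6) :=
        Finset.sum_le_sum fun b hb => mul_le_mul_of_nonneg_right (step3 b hb) (by positivity)
    _ ≤ ∑ b ∈ t, 125 * (D / δ) ^ 3 * D⁻¹ ^ 6 * ((b : ℝ) ^ 2)⁻¹ := Finset.sum_le_sum step4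
    _ = 125 * (D / δ) ^ 3 * D⁻¹ ^ 6 * ∑ b ∈ t, ((b : ℝ) ^ 2)⁻¹ := by rw [Finset.mul_sum]
    _ ≤ 125 * (D / δ) ^ 3 * D⁻¹ ^ 6 * 2 := mul_le_mul_of_nonneg_left step5 (by positivity)
    _ = 250 * (D / δ) ^ 3 * D⁻¹ ^ 6 := by ring

/-! ### A uniform upper bound on the nearest-neighbour distance in ground states -/

/-- **Every particle of a Lennard-Jones ground state has a neighbour within `10/δ`**, where
`δ ≤ 1` is any separation constant of the ground state: otherwise, by the far-field shell sum,
the site energy of the isolated particle would be `≥ -(1/6) · 250 · (D/δ)³ D⁻⁶ = -1/24` for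
`D = 10/δ`, contradicting `siteEnergy_le_of_isGroundState` (`≤ -1/12`). [folklore] -/
theorem exists_dist_lt_of_isGroundState {N : ℕ} {x : Fin N → EuclideanSpace ℝ (Fin 3)}
    (hx : IsGroundState lennardJones x) {δ : ℝ} (hδ : 0 < δ) (hδ1 : δ ≤ 1)
    (hsep : ∀ k l, k ≠ l → δ ≤ dist (x k) (x l)) {i m : Fin N} (hmi : m ≠ i) :
    ∃ k, k ≠ i ∧ dist (x i) (x k) < 10 / δ := by
  by_contra H
  push Not at H
  set D : ℝ := 10 / δ with hD_def
  have hδD : δ ≤ D := by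
    rw [hD_def, le_div_iff₀ hδ]
    nlinarith
  have hS := sum_inv_pow_six_le_of_far x hδ hδD hsep i H
  have hnum : (D / δ) ^ 3 * D⁻¹ ^ 6 = 1 / 1000 := by
    rw [hD_def]
    field_simp
    ring
  have hS' : ∑ k ∈ Finset.univ.erase i, (dist (x i) (x k))⁻¹ ^ 6 ≤ 1 / 4 := by
    rw [mul_assoc, hnum] at hS
    linarith
  have hA := siteEnergy_le_of_isGroundState (by norm_num) hx hmi
  have hexp : siteEnergy lennardJones x i =
      (1 / 12) * ∑ k ∈ Finset.univ.erase i, (dist (x i) (x k))⁻¹ ^ 12 -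
        (1 / 6) * ∑ k ∈ Finset.univ.erase i, (dist (x i) (x k))⁻¹ ^ 6 := by
    simp only [siteEnergy, lennardJones, Finset.sum_sub_distrib, Finset.mul_sum]
  have h12 : 0 ≤ ∑ k ∈ Finset.univ.erase i, (dist (x i) (x k))⁻¹ ^ 12 :=
    Finset.sum_nonneg fun k _ => by positivity
  linarith

/-- **Uniform upper bound on the own nearest-neighbour distance in Lennard-Jones ground states**:
`nn_i ≤ 10/δ` for every site `i` of every ground state in `ℝ³` with separation constant `δ ≤ 1`
(for a single particle `nn_i = 0`). [folklore] -/
theorem nearestDist_le_of_isGroundState {N : ℕ} {x : Fin N → EuclideanSpace ℝ (Fin 3)}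
    (hx : IsGroundState lennardJones x) {δ : ℝ} (hδ : 0 < δ) (hδ1 : δ ≤ 1)
    (hsep : ∀ k l, k ≠ l → δ ≤ dist (x k) (x l)) (i : Fin N) :
    nearestDist x i ≤ 10 / δ := by
  by_cases h : ∃ m, m ≠ i
  · obtain ⟨m, hm⟩ := h
    obtain ⟨k, hk, hlt⟩ := exists_dist_lt_of_isGroundState hx hδ hδ1 hsep hm
    exact (nearestDist_le_dist x hk).trans hlt.le
  · push Not at h
    haveI : Subsingleton (Fin N) := ⟨fun a b => (h a).trans (h b).symm⟩
    rw [nearestDist_eq_zero_of_subsingleton]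
    positivity

/-! ### The window count -/

/-- **Window count.** For a `δ`-separated configuration all of whose nearest-neighbour distances
are `≤ D`, the sites `i` whose window of relative radius `R` contains `x j`
(`dist (x i) (x j) ≤ R · nn_i`) are `δ`-separated points of the ball of radius `R · D` about
`x j`, hence number at most `(2RD/δ + 1)³`. [folklore] -/
theorem card_filter_window_le {N : ℕ} (x : Fin N → EuclideanSpace ℝ (Fin 3)) {δ D R : ℝ}
    (hδ : 0 < δ) (hD : 0 ≤ D) (hR : 0 ≤ R) (hsep : ∀ k l, k ≠ l → δ ≤ dist (x k) (x l))
    (hnn : ∀ i, nearestDist x i ≤ D) (j : Fin N) :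
    ((Finset.univ.filter fun i => dist (x i) (x j) ≤ R * nearestDist x i).card : ℝ) ≤
      (2 * (R * D) / δ + 1) ^ 3 := by
  classical
  set F := Finset.univ.filter fun i => dist (x i) (x j) ≤ R * nearestDist x i with hF
  have hinj : Set.InjOn x F := fun k _ l _ hkl => by
    by_contra hne
    have := hsep k l hne
    rw [hkl, dist_self] at this
    exact absurd this (not_le.2 hδ)
  rw [← Finset.card_image_of_injOn hinj]
  have hRD : (0 : ℝ) ≤ R * D := mul_nonneg hR hD
  have := card_le_of_separated_of_dist_le (F.image x) (x j) hδ hRD ?_ ?_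
  · rwa [finrank_euclideanSpace_fin] at this
  · intro c hc
    obtain ⟨k, hk, rfl⟩ := Finset.mem_image.1 hc
    have hk' := (Finset.mem_filter.1 hk).2
    exact hk'.trans (mul_le_mul_of_nonneg_left (hnn k) hR)
  · intro c hc c' hc' hne
    obtain ⟨k, -, rfl⟩ := Finset.mem_image.1 hc
    obtain ⟨l, -, rfl⟩ := Finset.mem_image.1 hc'
    exact hsep k l fun h => hne (h ▸ rfl)

/-! ### The glue -/

/-- **`LayeringGlue`** (item `stmt-AtomisticToContinuum-14237` of route PricedLinkCensus):
`ZeroChargeBulk → ChargeFreeWindows`. For a sequence of Lennard-Jones ground states and `R > 0`,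
a site `i` whose `R · nn_i`-window contains a site that is not charge-free lies in the window set
of a charged site `j`; each such set has at most `K = (2R(10/δ)/δ + 1)³` elements
(`card_filter_window_le` with `nearestDist_le_of_isGroundState` and the minimal distance
`δ = min δ₀ 1`, `δ₀` from `LennardJonesMinimalDistance_holds`), so the bad fraction is at most
`K` times the charged fraction, which tends to `0` by `ZeroChargeBulk`. [folklore] -/
theorem layeringGlue_proof : LayeringGlue := by
  unfold LayeringGlue ZeroChargeBulk ChargeFreeWindows
  intro hZ R hR x hx
  classical
  obtain ⟨δ₀, hδ₀, hsep₀⟩ := LennardJonesMinimalDistance_holds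
  set δ : ℝ := min δ₀ 1 with hδ_def
  have hδ : 0 < δ := lt_min hδ₀ one_pos
  have hδ1 : δ ≤ 1 := min_le_right _ _
  have hsep : ∀ (N : ℕ) (k l : Fin N), k ≠ l → δ ≤ dist (x N k) (x N l) := fun N k l hkl =>
    (min_le_left _ _).trans (hsep₀ N (x N) (hx N) k l hkl)
  set K : ℝ := (2 * (R * (10 / δ)) / δ + 1) ^ 3 with hK_def
  -- the double count, for every `N`
  have hcount : ∀ N : ℕ,
      (Nat.card {i : Fin N // ¬ ∀ j : Fin N, dist (x N i) (x N j) ≤ R * nearestDist (x N) i →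
        IsChargeFree (1 / 100 : ℝ) (x N) j} : ℝ) ≤
        K * Nat.card {i : Fin N // ¬ IsChargeFree (1 / 100 : ℝ) (x N) i} := by
    intro N
    set bad := Finset.univ.filter fun i : Fin N => ¬ ∀ j : Fin N,
      dist (x N i) (x N j) ≤ R * nearestDist (x N) i → IsChargeFree (1 / 100 : ℝ) (x N) j
      with hbad
    set charged := Finset.univ.filter fun j : Fin N => ¬ IsChargeFree (1 / 100 : ℝ) (x N) j
      with hcharged
    set W : Fin N → Finset (Fin N) := fun j =>
      Finset.univ.filter fun i => dist (x N i) (x N j) ≤ R * nearestDist (x N) i with hW_def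
    rw [Nat.subtype_card bad (fun i => by simp [hbad]),
      Nat.subtype_card charged (fun i => by simp [hcharged])]
    have hsub : bad ⊆ charged.biUnion W := by
      intro i hi
      obtain ⟨-, hi⟩ := Finset.mem_filter.1 hi
      push Not at hi
      obtain ⟨j, hij, hj⟩ := hi
      exact Finset.mem_biUnion.2 ⟨j, Finset.mem_filter.2 ⟨Finset.mem_univ _, hj⟩,
        Finset.mem_filter.2 ⟨Finset.mem_univ _, hij⟩⟩
    have hW : ∀ j, ((W j).card : ℝ) ≤ K := fun j =>
      card_filter_window_le (x N) hδ (by positivity) hR.le (hsep N)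
        (fun i => nearestDist_le_of_isGroundState (hx N) hδ hδ1 (hsep N) i) j
    calc (bad.card : ℝ) ≤ ((charged.biUnion W).card : ℝ) := by
          exact_mod_cast Finset.card_le_card hsub
      _ ≤ ∑ j ∈ charged, ((W j).card : ℝ) := by exact_mod_cast Finset.card_biUnion_le
      _ ≤ ∑ j ∈ charged, K := Finset.sum_le_sum fun j _ => hW j
      _ = K * charged.card := by rw [Finset.sum_const, nsmul_eq_mul, mul_comm]
  -- squeeze between `0` and `K ·` (charged fraction)
  have hlim := (hZ x hx).const_mul K
  rw [mul_zero] at hlim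
  refine squeeze_zero (fun N => by positivity) (fun N => ?_) hlim
  rw [← mul_div_assoc]
  exact div_le_div_of_nonneg_right (hcount N) (Nat.cast_nonneg N)

end Summit.AtomisticToContinuum.Crystallization.Theorems

end
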